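import Summits.BirchSwinnertonDyer.Rank1Residual.F1Sign2.UnitDoorParityAtTwo
import Summits.BirchSwinnertonDyer.Rank1Residual.F1Sign2.TwistedMinusSymbolSumProofs
import Summits.BirchSwinnertonDyer.BirchSwinnertonDyer.Theorems.ByReductionTypeAtTwoRankOneAtTwoBigImageOddLocalOneDoorHalvesJointCrossed
import Summits.BirchSwinnertonDyer.Rank1Residual.F1Sign2.DescentSignAtTwo
import Summits.BirchSwinnertonDyer.Rank1Residual.F1Sign2.TranspositionDoorAtTwo
import Literature.NumberTheory.EllipticCurves.PAdicLFunctionMinus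
import Literature.NumberTheory.EllipticCurves.PAdicLFunctionMinusDistributionProofs
import Literature.NumberTheory.EllipticCurves.PAdicLFunctionMinusIntegralityProofs
import Literature.NumberTheory.EllipticCurves.ModularFormsGamma0Genus
import Literature.NumberTheory.EllipticCurves.GrossZagierRationalPointPeriodProofs
import Literature.NumberTheory.EllipticCurves.ImaginaryPeriod
import Literature.NumberTheory.EllipticCurves.LFunctionSmulProofs
import Literature.NumberTheory.EllipticCurves.BSDQuadraticDescentPeriodEliminationProofs
import Literature.NumberTheory.EllipticCurves.ComplexMultiplicationBurungaleFlachProofs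
import Literature.NumberTheory.EllipticCurves.ModularCurveMinusPeriodRatio
import Literature.NumberTheory.EllipticCurves.Pal2012.QuadraticTwistPeriodProofs
import Literature.NumberTheory.EllipticCurves.NoConductorOne
import Literature.NumberTheory.EllipticCurves.LFunctionPrimeCoeff
import Literature.NumberTheory.EllipticCurves.NonEisensteinPrimeOfSurjective
import Literature.NumberTheory.EllipticCurves.ModularSymbolsNormalizedSymbolProofs
import Literature.NumberTheory.EllipticCurves.ModularSymbolsProofs
import Literature.NumberTheory.EllipticCurves.GlobalMinimalModelProofs
import Summits.BirchSwinnertonDyer.BirchSwinnertonDyer.Theorems.GenusKolyvaginAtTwoGenusPrimitiveSupplyAtTwoPrimeHeegnerTwinSilentPrimes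
import Mathlib.NumberTheory.LegendreSymbol.GaussEisensteinLemmas
import Summits.BirchSwinnertonDyer.Rank1Residual.F1Sign2.TwistedMinusSymbolSumAwayProofs
import HarnessLib

/-!
# Cell `bsd-f1-sign2`, AN-33n/o/q PROOFS (§9): the explicit quotient `L(Wd,1)/Ω(Wd)` under a quadratic twist, its 2-adic valuation at unit-class doors, and the value clause of `hSup` — KERNEL-CHECKED (-an g16, Sketch_v37 §9)

PORT (cell `bsd-f1-sign2`, seat `-ty` g11) of -an g16's tree-rebased file of record `MEMO-an-data/g16/Sketch_v37.lean` 454eaaa5b944aeb6 (= MEMO-an v1.40 /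
`Sketch_v36.lean` 335ae8cb61bfaf5b rebased on the tree: imports `F1Sign2/UnitDoorParityAtTwo` + `F1Sign2/TwistedMinusSymbolSumProofs`, the 37 decls
byte-identical in the tree deleted, the v32-generalised «units AWAY from M» helpers renamed `…_away`; farm rc 0 · 0 err · 0 warn · 0 sorry,
`bc/Sketch_v37_check.json` 6d9656a1424da834; evidence #60 on stmt-23715).  REF1 §126 (refuter-bsd-f1-sign2-ref1 g11, 2026-08-28T17:18:39Z): «§4–§10 Away
generalisation clean; 29/29 new theorems axioms {propext, Classical.choice, Quot.sound}».  Typer edits = this header, the section ranges, added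
docstrings on undocumented helpers; proofs VERBATIM.  Nothing here proves BSD; 23715 not closed.
Section §9 of the port file (AN-33n `entireLFunction_div_realPeriodRat_of_twist_eq` — KNOWN bookkeeping, REF2 v35-add1 §A1: Birch–Manin twisted-symbol
formula + Pal 2012 Thm 3.2, both tree facts; AN-33o `exists_rat_value_div_period_of_unitClass`, `…_le_…`; AN-33q `doorUnitValueAt_of_pureCycle_of_periodIndex`;
AN-33r `doorUnitValueAt_of_eggPeriodIndexLaw` — from the `@[conjecture]` AN-33p `EggPeriodIndexLawAtTwo` of `F1Sign2/UnitDoorParityAtTwo.lean`).  Imports =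
the port file's import list (tree modules only) + the AWAY proofs chain `F1Sign2/TwistedMinusSymbolSumAwayProofs.lean`.
[cite: Pal2012, Thm. 3.2, Prop. 2.5] [cite: MazurTateTeitelbaum1986, §I.8]
-/

set_option autoImplicit false

noncomputable section

open scoped Classical MatrixGroups ModularForm

open CongruenceSubgroup WeierstrassCurve NumberField Literature.NumberTheory.EllipticCurves Literature.NumberTheory.EllipticCurves.ModularForms
  Literature.NumberTheory.EllipticCurves.Rank1Residual
  Literature.NumberTheory.EllipticCurves.Rank1Residual.Typed
  Summit.BirchSwinnertonDyer.Rank1Residual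
  Summit.BirchSwinnertonDyer.Rank1Residual.F1Sign2
  Summit.BirchSwinnertonDyer.Rank1Residual.F1Sign2.TranspositionDoor
  Summit.BirchSwinnertonDyer.BirchSwinnertonDyer.Theorems.RankOneAtTwoOneDoor

namespace Summit.BirchSwinnertonDyer.Rank1Residual.F1Sign2.ANg16

/-! ## 9. (v29) AN-33n/o/q: the explicit quotient `L(Wd,1)/Ω(Wd)`, its 2-adic valuation at unit-class doors, and the value clause of `hSup`
from a 2-adic period-index bound (signed Birch + Pal 2012 Thm 3.2 + `entireLFunction_smul`; standalone dev `g16/AN33n_PeriodQuotient_dev.lean`) -/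

section PeriodQuotient

open scoped NumberTheorySymbols

open Literature.NumberTheory.QuadraticFields

variable {N : ℕ} [NeZero N] {f : CuspForm (Gamma0 N) 2}


/-- **AN-33n (PROVED): the explicit value/period quotient of an odd quadratic twist.**  For `W/ℚ` elliptic with newform `f`
(`IsNewformOf W f`, `hasEntireLFunction_rat`), a discriminant `d < 0`, `d ≡ 1 (mod 4)` square-free with `gcd(d, N_W) = 1`, ANY model
`Wd = C • W^{(d)}` of the twist, and the rational period index `κ` with `Ω⁻_f = κ · |Ω⁻(W)|` (supplied with `κ = k/c` by
`exists_int_maninConstant_mul_minusPeriod_eq` for a parametrisation datum):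
`L(Wd, 1)/Ω(Wd) = Σ_d · κ / (|u(C)| · c_∞(W))`, where `Σ_d = Σ_{a mod |d|} (a/|d|)[a/|d|]⁻_f` is the (rational) twisted minus-symbol
sum and `c_∞(W) = 2` if `Δ(W) > 0`, `1` otherwise.  Ingredients (all tree): signed Birch `ratMinusTwistedSymbolSum_jacobiChar_mul_minusPeriod`
(`Σ_d · Ω⁻_f = √|d| · L(W^{(d)},1)`), Pal 2012 Thm 3.2 `realPeriodRat_mul_sqrt_of_twist_of_neg'` (`Ω(Wd)√|d| = |u(C)| c_∞(W) |Ω⁻(W)|`),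
`numRealComponents_baseChange_real`, `entireLFunction_smul`, `LFunction_quadraticTwist_apply_of_int_gcd_eq_one`. -/
theorem entireLFunction_div_realPeriodRat_of_twist_eq (hE : hasEntireLFunction_rat)
    (W : WeierstrassCurve ℚ) [W.IsElliptic] (hfW : IsNewformOf W f)
    {d : ℤ} (hd0 : d < 0) (hsq : Squarefree d) (hd4 : d % 4 = 1) (hgcd : Int.gcd d (W.conductorNorm ℤ) = 1)
    (Wd : WeierstrassCurve ℚ) (C : VariableChange ℚ) (hC : C • W.quadraticTwist (d : ℚ) = Wd)
    {κ : ℚ} (hκ : minusPeriod f = (κ : ℝ) * W.imaginaryPeriodRat) :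
    haveI : NeZero d.natAbs := ⟨Int.natAbs_ne_zero.mpr hsq.ne_zero⟩
    Wd.entireLFunction 1 / (Wd.realPeriodRat : ℂ) =
      ratMinusTwistedSymbolSum f (jacobiChar d.natAbs) *
        (((κ / (|(C.u : ℚ)| * (if 0 < W.Δ then 2 else 1))) : ℚ) : ℂ) := by
  set D : ℕ := d.natAbs with hDdef
  haveI : NeZero D := ⟨Int.natAbs_ne_zero.mpr hsq.ne_zero⟩
  have hDd : (D : ℤ) = -d := by rw [hDdef]; omega
  have hD3 : D % 4 = 3 := by omega
  have hDsq : Squarefree D := Int.squarefree_natAbs.mpr hsq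
  have hdq : (d : ℚ) ≠ 0 := by exact_mod_cast hsq.ne_zero
  have hdq0 : (d : ℚ) < 0 := by exact_mod_cast hd0
  haveI := W.isElliptic_quadraticTwist hdq
  have hEt : (W.quadraticTwist (d : ℚ)).HasEntireLFunction := hE _
  -- (1) signed Birch: `Σ · Ω⁻_f = √D · L(W^{(d)}, 1)`
  have hco : ∀ n : ℕ, (((W.quadraticTwist (d : ℚ)).LFunction n : ℤ) : ℂ) = jacobiChar D n * cuspCoeff f n := fun n ↦ by
    rw [LFunction_quadraticTwist_apply_of_int_gcd_eq_one W hd4 hsq hgcd n, Int.cast_mul, jacobiChar_natCast, hfW.2 n]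
  have hL' : ∀ s : ℂ, 2 < s.re → (W.quadraticTwist (d : ℚ)).entireLFunction s = twistedLSeries f (jacobiChar D) s := by
    intro s hs
    rw [(W.quadraticTwist (d : ℚ)).entireLFunction_eq_LSeries hEt (by linarith)]
    unfold WeierstrassCurve.LSeries twistedLSeries
    congr 1
    funext n
    exact hco n
  have hB := ratMinusTwistedSymbolSum_jacobiChar_mul_minusPeriod hfW.1 hfW.coeffField_eq_bot hDsq hD3
    ((W.quadraticTwist (d : ℚ)).differentiable_entireLFunction hEt) hL'
  -- (2) the model `Wd` has the same `L`-function
  have hLeq : Wd.entireLFunction = (W.quadraticTwist (d : ℚ)).entireLFunction := by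
    rw [← hC, entireLFunction_smul]
  -- (3) Pal: `Ω(Wd) · √D = |u(C)| · c_∞(W) · |Ω⁻(W)|`
  set A : ℚ := |(C.u : ℚ)| with hAdef
  set c' : ℚ := if 0 < W.Δ then 2 else 1 with hc'def
  have hP := W.realPeriodRat_mul_sqrt_of_twist_of_neg' hdq0 Wd C hC
  have hDR : -((d : ℚ) : ℝ) = ((D : ℕ) : ℝ) := by
    have : ((D : ℕ) : ℝ) = ((D : ℤ) : ℝ) := by norm_cast
    rw [this, hDd]; push_cast; ring
  have hcR : ((W.baseChange ℝ).numRealComponents : ℝ) = ((c' : ℚ) : ℝ) := by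
    rw [W.numRealComponents_baseChange_real, hc'def]
    split_ifs <;> norm_num
  have hAR : |((C.u : ℚ) : ℝ)| = ((A : ℚ) : ℝ) := by rw [hAdef, Rat.cast_abs]
  rw [hDR, hcR, hAR] at hP
  -- hP : Wd.realPeriodRat * √D = A * c' * |Ω⁻(W)|
  have hPC : (Wd.realPeriodRat : ℂ) * (Real.sqrt ((D : ℕ) : ℝ) : ℂ) =
      ((A : ℚ) : ℂ) * ((c' : ℚ) : ℂ) * (W.imaginaryPeriodRat : ℂ) := by
    have := congrArg (fun x : ℝ => (x : ℂ)) hP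
    simpa using this
  -- (4) `Ω⁻_f = κ · |Ω⁻(W)|`
  have hκC : ((minusPeriod f : ℝ) : ℂ) = ((κ : ℚ) : ℂ) * (W.imaginaryPeriodRat : ℂ) := by
    rw [hκ]; push_cast; ring
  -- (5) `q · (A · c') = κ`
  have hA0 : A ≠ 0 := by rw [hAdef]; exact abs_ne_zero.mpr (Units.ne_zero _)
  have hc0 : c' ≠ 0 := by rw [hc'def]; split_ifs <;> norm_num
  have hq : κ / (A * c') * (A * c') = κ := div_mul_cancel₀ κ (mul_ne_zero hA0 hc0)
  have hqC : ((κ / (A * c') : ℚ) : ℂ) * (((A : ℚ) : ℂ) * ((c' : ℚ) : ℂ)) = ((κ : ℚ) : ℂ) := by exact_mod_cast hq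
  -- (6) assemble: divide by `Ω(Wd) ≠ 0`, cancel `√D ≠ 0`
  have hRpos : 0 < Wd.realPeriodRat := by
    haveI : Wd.IsElliptic := by rw [← hC]; infer_instance
    exact Wd.realPeriodRat_pos_holds
  have hRne : (Wd.realPeriodRat : ℂ) ≠ 0 := by exact_mod_cast hRpos.ne'
  have hSpos : 0 < Real.sqrt ((D : ℕ) : ℝ) := Real.sqrt_pos.mpr (by exact_mod_cast Nat.pos_of_ne_zero (NeZero.ne D))
  have hSne : (Real.sqrt ((D : ℕ) : ℝ) : ℂ) ≠ 0 := by exact_mod_cast hSpos.ne'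
  rw [div_eq_iff hRne, hLeq]
  apply mul_left_cancel₀ hSne
  rw [← hB, hκC]
  linear_combination (-(ratMinusTwistedSymbolSum f (jacobiChar D) * ((κ / (A * c') : ℚ) : ℂ))) * hPC
    - (ratMinusTwistedSymbolSum f (jacobiChar D) * (W.imaginaryPeriodRat : ℂ)) * hqC

/-- **AN-33o (PROVED): the 2-adic valuation of `L(Wd,1)/Ω(Wd)` at a unit-class door.**  In the situation of AN-33n, if the twisted
symbol sum lies in the unit class `Σ_d ∈ 2u·(2ℤ+1)` (which AN-33k gives at every pure `3`-cycle door of an `η_f = 1` form), then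
`L(Wd,1)/Ω(Wd) = qd ∈ ℚ` with `v₂(qd) = v₂(2uκ/(|u(C)|·c_∞(W)))` — a quantity depending on `W`, the symbol unit, the period index
`κ` and the model scaling `|u(C)|` only, NOT on the door beyond `u(C)`. -/
theorem exists_rat_value_div_period_of_unitClass (hE : hasEntireLFunction_rat)
    (W : WeierstrassCurve ℚ) [W.IsElliptic] (hfW : IsNewformOf W f)
    {d : ℤ} (hd0 : d < 0) (hsq : Squarefree d) (hd4 : d % 4 = 1) (hgcd : Int.gcd d (W.conductorNorm ℤ) = 1)
    (Wd : WeierstrassCurve ℚ) (C : VariableChange ℚ) (hC : C • W.quadraticTwist (d : ℚ) = Wd)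
    {κ : ℚ} (hκ : minusPeriod f = (κ : ℝ) * W.imaginaryPeriodRat) {u : ℚ} (hu0 : u ≠ 0)
    (hS : haveI : NeZero d.natAbs := ⟨Int.natAbs_ne_zero.mpr hsq.ne_zero⟩
      ∃ w : ℤ, ratMinusTwistedSymbolSum f (jacobiChar d.natAbs) = (((2 : ℚ) * (2 * w + 1) * u : ℚ) : ℂ)) :
    ∃ qd : ℚ, Wd.entireLFunction 1 / (Wd.realPeriodRat : ℂ) = (qd : ℂ) ∧
      padicValRat 2 qd = padicValRat 2 (2 * u * κ / (|(C.u : ℚ)| * (if 0 < W.Δ then 2 else 1))) := by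
  haveI : NeZero d.natAbs := ⟨Int.natAbs_ne_zero.mpr hsq.ne_zero⟩
  obtain ⟨w, hw⟩ := hS
  have hn := entireLFunction_div_realPeriodRat_of_twist_eq hE W hfW hd0 hsq hd4 hgcd Wd C hC hκ
  set c' : ℚ := if 0 < W.Δ then 2 else 1 with hc'def
  set A : ℚ := |(C.u : ℚ)| with hAdef
  refine ⟨(2 * w + 1 : ℤ) * (2 * u * κ / (A * c')), ?_, ?_⟩
  · rw [hn, hw]; push_cast; ring
  · -- `κ ≠ 0` from `Ω⁻_f > 0`; `A, c' ≠ 0`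
    have hκ0 : κ ≠ 0 := by
      intro h0
      have hpos : 0 < minusPeriod f := IsNewform0.minusPeriod_pos_holds hfW.1 hfW.coeffField_eq_bot
      rw [hκ, h0] at hpos; simp at hpos
    have hA0 : A ≠ 0 := by rw [hAdef]; exact abs_ne_zero.mpr (Units.ne_zero _)
    have hc0 : c' ≠ 0 := by rw [hc'def]; split_ifs <;> norm_num
    have hx0 : 2 * u * κ / (A * c') ≠ 0 :=
      div_ne_zero (mul_ne_zero (mul_ne_zero two_ne_zero hu0) hκ0) (mul_ne_zero hA0 hc0)
    have hw0 : ((2 * w + 1 : ℤ) : ℚ) ≠ 0 := by exact_mod_cast (show (2 * w + 1 : ℤ) ≠ 0 by omega)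
    haveI : Fact (Nat.Prime 2) := ⟨Nat.prime_two⟩
    rw [padicValRat.mul hw0 hx0, padicValRat.of_int, padicValInt.eq_zero_of_not_dvd (by omega)]
    simp

/-- **AN-33o′ (PROVED, lead-facing): the value clause of `hSup` at a unit-class door from a 2-adic period-index bound.**
If moreover `v₂(2uκ/(|u(C)|·c_∞(W))) ≤ t` then `L(Wd,1)/Ω(Wd) = qd` with `v₂(qd) ≤ t` (for `hSup`: `t = transpCount + 2·identCount`,
`= 0` at pure `3`-cycle doors). -/
theorem exists_rat_value_div_period_le_of_unitClass (hE : hasEntireLFunction_rat)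
    (W : WeierstrassCurve ℚ) [W.IsElliptic] (hfW : IsNewformOf W f)
    {d : ℤ} (hd0 : d < 0) (hsq : Squarefree d) (hd4 : d % 4 = 1) (hgcd : Int.gcd d (W.conductorNorm ℤ) = 1)
    (Wd : WeierstrassCurve ℚ) (C : VariableChange ℚ) (hC : C • W.quadraticTwist (d : ℚ) = Wd)
    {κ : ℚ} (hκ : minusPeriod f = (κ : ℝ) * W.imaginaryPeriodRat) {u : ℚ} (hu0 : u ≠ 0)
    (hS : haveI : NeZero d.natAbs := ⟨Int.natAbs_ne_zero.mpr hsq.ne_zero⟩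
      ∃ w : ℤ, ratMinusTwistedSymbolSum f (jacobiChar d.natAbs) = (((2 : ℚ) * (2 * w + 1) * u : ℚ) : ℂ))
    {t : ℤ} (hv : padicValRat 2 (2 * u * κ / (|(C.u : ℚ)| * (if 0 < W.Δ then 2 else 1))) ≤ t) :
    ∃ qd : ℚ, Wd.entireLFunction 1 / (Wd.realPeriodRat : ℂ) = (qd : ℂ) ∧ padicValRat 2 qd ≤ t := by
  obtain ⟨qd, hqd, hv'⟩ := exists_rat_value_div_period_of_unitClass hE W hfW hd0 hsq hd4 hgcd Wd C hC hκ hu0 hS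
  exact ⟨qd, hqd, hv'.symm ▸ hv⟩

/-- **AN-33q (PROVED, W-level): every pure-`3`-cycle door of an `η = 1` curve is a UNIT DOOR in value currency, GIVEN the 2-adic period-index
bound.**  Hypotheses: modularity (`hasEntireLFunction_rat`, `IsNewformOf W f`), a symbol unit `u` with `η_f = 1`, a door `d < 0`, `d ≡ 1 (4)`
square-free, `gcd(d, N_W) = 1`, all prime factors `q ∤ N` with `a_q` odd, a globally minimal model `Wd = C • W^{(d)}`, the period index `κ`
(`Ω⁻_f = κ|Ω⁻(W)|`), and `v₂(2uκ/(|u(C)|·c_∞(W))) ≤ t(d) + 2s(d)`.  Conclusion: `DoorUnitValueAt W d` (both conjuncts: AN-33m and AN-33o′). -/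
theorem doorUnitValueAt_of_pureCycle_of_periodIndex (hE : hasEntireLFunction_rat)
    (W : WeierstrassCurve ℚ) [W.IsElliptic] [W.IsGloballyMinimal] (hfW : IsNewformOf W f) {u : ℚ} (hu : IsMinusSymbolUnitAway f N u)
    {q₀ : ℕ} {a₀ : ℤ} (hq₀ : q₀.Prime) (hq₀o : Odd q₀) (hq₀N : ¬ q₀ ∣ N) (ha₀ : cuspCoeff f q₀ = (a₀ : ℂ)) (ha₀o : Odd a₀)
    (hη : ∃ z₀ : ℤ, minusHalfSum f q₀ = (2 * z₀ + 1) * u)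
    (a : ℕ → ℤ) {d : ℤ} (hd0 : d < 0) (hsq : Squarefree d) (hd4 : d % 4 = 1) (hgcd : Int.gcd d (W.conductorNorm ℤ) = 1)
    (hpr : ∀ q ∈ d.natAbs.primeFactors, ¬ q ∣ N ∧ cuspCoeff f q = (a q : ℂ)) (hpure : ∀ q ∈ d.natAbs.primeFactors, Odd (a q))
    (Wd : WeierstrassCurve ℚ) [Wd.IsElliptic] [Wd.IsGloballyMinimal] (C : VariableChange ℚ) (hC : C • W.quadraticTwist (d : ℚ) = Wd)
    {κ : ℚ} (hκ : minusPeriod f = (κ : ℝ) * W.imaginaryPeriodRat)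
    (hv : padicValRat 2 (2 * u * κ / (|(C.u : ℚ)| * (if 0 < W.Δ then 2 else 1))) ≤ transpCount W d + 2 * identCount W d) :
    DoorUnitValueAt W d := by
  refine ⟨entireLFunction_quadraticTwist_one_ne_zero_of_pureCycle_away f hE W hfW hu hq₀ hq₀o hq₀N ha₀ ha₀o hη a hd0 hsq hd4 hgcd hpr hpure, ?_⟩
  -- the unit class of `Σ_d` from AN-33k at the pure level `|d|` and `η_f = 1`
  set D : ℕ := d.natAbs with hDdef
  haveI : NeZero D := ⟨Int.natAbs_ne_zero.mpr hsq.ne_zero⟩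
  have hD3 : D % 4 = 3 := by omega
  have hDsq : Squarefree D := Int.squarefree_natAbs.mpr hsq
  have hDodd : Odd D := Nat.odd_iff.mpr (by omega)
  have hD1 : 1 < D := by omega
  have hχo : (jacobiChar D).Odd := jacobiChar_neg_one_of_mod_four_eq_three hD3
  have hq : ∀ x : (ZMod D)ˣ, jacobiChar D x = 1 ∨ jacobiChar D x = -1 := by
    intro x
    rcases isQuadratic_jacobiChar (q := D) (x : ZMod D) with h0 | h1 | h2
    · exact absurd ((Units.isUnit x).map (jacobiChar D)) (by rw [h0]; exact not_isUnit_zero)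
    · exact Or.inl h1
    · exact Or.inr h2
  obtain ⟨z, hz⟩ := (twistedMinusSymbolSum_unitClassLaw f hfW.1 hfW.coeffField_eq_bot hu hq₀ hq₀o hq₀N
    ((Nat.Prime.coprime_iff_not_dvd hq₀).mpr hq₀N) ha₀ ha₀o a hDsq hDodd
    (coprime_of_primeFactors_not_dvd (NeZero.ne D) fun q hq' => (hpr q hq').1) hpr (jacobiChar D) hχo hq).1 ⟨hD1, hpure⟩
  obtain ⟨z₀, hz₀⟩ := hη
  have hS : ∃ w : ℤ, ratMinusTwistedSymbolSum f (jacobiChar D) = (((2 : ℚ) * (2 * w + 1) * u : ℚ) : ℂ) := by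
    refine ⟨z₀ + z, ?_⟩
    rw [hz, hz₀]; push_cast; ring
  obtain ⟨qd, hqd, hle⟩ := exists_rat_value_div_period_le_of_unitClass hE W hfW hd0 hsq hd4 hgcd Wd C hC hκ (ne_of_gt hu.1) hS hv
  exact ⟨Wd, ‹_›, ‹_›, C, qd, hC, hqd, hle⟩

/-- **AN-33r (PROVED glue): `EggPeriodIndexLawAtTwo` + modularity ⇒ every admissible pure-`3`-cycle door of an egg-class slice curve is a unit
door.**  With the newform at level `N_W` (so `q ∣ d`, `gcd(d, N_W) = 1 ⇒ q ∤ N`), `a_q(f) = a_q(W)` (`IsNewformOf`), and any globally minimal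
model of the twist.  Hence `hSup` on the egg sub-slice ⟸ AN-33p + ONE door-admissible pure-`3`-cycle `d_K` per curve (Chebotarev). -/
theorem doorUnitValueAt_of_eggPeriodIndexLaw (hP : EggPeriodIndexLawAtTwo) (hE : hasEntireLFunction_rat)
    (W : WeierstrassCurve ℚ) [W.IsElliptic] [W.IsGloballyMinimal] [NeZero (W.conductorNorm ℤ)]
    (hCM : ¬ W.HasCM) (hsurj : ∀ n : ℕ, W.HasSurjectiveModNGaloisRep ((2 ^ n : ℕ) : ℤ)) (htor : Odd W.torsionOrder)
    (htam : Odd W.tamagawaProduct) (hrk : W.analyticRank = 1) (hΔ : 0 < W.Δ) (hegg : MeetsEgg W) (hSha : ShaTwoTrivial W)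
    (g : CuspForm (Gamma0 (W.conductorNorm ℤ)) 2) (hgW : IsNewformOf W g)
    {d : ℤ} (hd0 : d < 0) (hsq : Squarefree d) (hd4 : d % 4 = 1) (hgcd : Int.gcd d (W.conductorNorm ℤ) = 1)
    (hpure : ∀ q ∈ d.natAbs.primeFactors, Odd (W.LFunction q))
    (Wd : WeierstrassCurve ℚ) [Wd.IsElliptic] [Wd.IsGloballyMinimal] (C : VariableChange ℚ) (hC : C • W.quadraticTwist (d : ℚ) = Wd) :
    DoorUnitValueAt W d := by
  obtain ⟨u, κ, hu, hκ, ⟨q₀, a₀, z₀, hq₀, hq₀o, hq₀N, ha₀, ha₀o, hz₀⟩, hlaw⟩ :=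
    hP W hCM hsurj htor htam hrk hΔ hegg hSha (W.conductorNorm ℤ) g hgW
  have hv0 := hlaw d hd0 hsq hd4 hgcd Wd C hC
  -- prime factors of `d` do not divide the level `N_W`
  have hpr : ∀ q ∈ d.natAbs.primeFactors, ¬ q ∣ W.conductorNorm ℤ ∧ cuspCoeff g q = ((W.LFunction q : ℤ) : ℂ) := by
    intro q hq
    have hqp : q.Prime := Nat.prime_of_mem_primeFactors hq
    have hqd : q ∣ d.natAbs := Nat.dvd_of_mem_primeFactors hq
    refine ⟨fun hqN => ?_, hgW.2 q⟩
    have h1 : q ∣ Int.gcd d (W.conductorNorm ℤ) := by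
      rw [Int.gcd_eq_natAbs]
      exact Nat.dvd_gcd hqd (by simpa using hqN)
    rw [hgcd] at h1
    exact hqp.one_lt.ne' (Nat.dvd_one.mp h1)
  have hv : padicValRat 2 (2 * u * κ / (|(C.u : ℚ)| * (if 0 < W.Δ then 2 else 1))) ≤ transpCount W d + 2 * identCount W d := by
    rw [if_pos hΔ]
    have hA0 : |(C.u : ℚ)| ≠ 0 := abs_ne_zero.mpr (Units.ne_zero _)
    have h2 : 2 * u * κ / (|(C.u : ℚ)| * 2) = u * κ / |(C.u : ℚ)| := by
      field_simp
    rw [h2]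
    exact hv0.trans (by positivity)
  exact doorUnitValueAt_of_pureCycle_of_periodIndex hE W hgW (hu.away _) hq₀ hq₀o hq₀N ha₀ ha₀o ⟨z₀, hz₀⟩ (fun q => W.LFunction q)
    hd0 hsq hd4 hgcd hpr hpure Wd C hC hκ hv

end PeriodQuotient

end Summit.BirchSwinnertonDyer.Rank1Residual.F1Sign2.ANg16
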